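import Literature.Computability.Complexity.GateEliminationNewTroubled

/-!
# Gate elimination: the protected substitution of Case 6 of Li–Yang's Theorem 4.1

Case 6 of §4.1 (ECCC TR21-023, p. 28–29): "Let `x` be a protected variable. By Case 1 and Case 2,
it is a `1`-variable feeding an ⊕-type gate `P`. Now we try to substitute `x ← d` and normalize
the circuit. At least `P` will be eliminated by Rule 3. We now rule out all cases when this
operation does not give `Δμ = 1 + α_I + α_Q`", concluding "From now on, we assume that
substituting constant value to a protected variable will eliminate exactly one gate without
introducing any troubled ones, hence `Δμ = 1 + α_I + α_Q`."

PROVED here, under the standing assumptions from Case 6 on (`Standing`, no ∧-type gate fed by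
two variables):

* `Semicircuit.exists_elimDataW_degen` — exact elimination data for a degenerate gate fed by a
  constant (Rule 3, output or not) whose replacement node is KNOWN to be the live wire;
* `Semicircuit.protSubst_dichotomy` — **the dichotomy of Case 6**: after `x := d` (source
  `assignProtected`) and the bypass of `P` (an `ElimDataW` with replacement the other wire of
  `P`), either the one-step conclusion `StepGoal` already holds (Case 6.1: a second gate is
  eliminated by Rule 5 or Rule 4, `Δμ ≥ 2 - 2α_φ + α_Q + α_I ≥ δ`; Case 6.2: a troubled gate
  appears — then the live wire of `P` is a variable `u` read, with a variable `t`, by an ∧-type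
  reader `B` of `P`, and Cases 6.2.2.1–6.2.2.4 apply), or the new circuit has no troubled gate,
  is normalized, and `μ' + 1 + α_I + α_Q ≤ μ` at the empty packings.

## References

* J. Li, T. Yang, *3.1n − o(n) circuit lower bounds for explicit functions*, STOC 2022;
  ECCC TR21-023, §3.3 (Rules 3–5), Lemma 3.11, §4.1 (Case 6, Cases 6.1, 6.2).
-/

namespace Literature.Computability.Complexity

open Finset

namespace Semicircuit

variable {n : ℕ} {C : Semicircuit n} {f : (Fin n → ZMod 2) → Bool} {R : RdqSource n} {d : ℕ} {αφ αI αQ : ℝ}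

/-- **Exact elimination data for a degenerate gate fed by a constant, with known replacement**
(Rule 3, output or not: if `k₀` is the output, the output moves to the live wire, a gate, after
flipping it if the degenerate function is the negation): the replacement node is the live wire
`C.arg k₀ a₀.rev`. [cite: LiYang2022, §3.3 (Rule 3), Lemma 3.11] -/
theorem exists_elimDataW_degen (hf : IsAffineDisperser f d) (hd : 2 * d + 2 ≤ R.dim) (hF : C.Fair)
    (hC : C.ComputesRestr f R) {P : Finset (Fin C.m × Fin C.m)} (hP : C.IsPacking P)
    {k₀ : Fin C.m} {a₀ : Fin 2} {b : Bool} (h₀ : C.arg k₀ a₀ = .const b) {neg : Bool}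
    (hdeg : ∀ t, C.liveFn k₀ a₀ b t = (t ^^ neg)) (hφ : 0 ≤ αφ) (hI : 0 ≤ αI) (αQ : ℝ) :
    ∃ E : ElimDataW C k₀ f R αφ αI αQ P (1 - αφ), E.repl = C.arg k₀ a₀.rev := by
  have hself := hF.not_reads_self_of_const h₀
  by_cases hout : C.out = .gate k₀
  · cases hk₁ : C.arg k₀ a₀.rev with
    | const b' => exact absurd hout (out_ne_of_const_const hf (by omega) hF hC h₀ hk₁)
    | var i => exact absurd hout (out_ne_of_live_var hf hd hF hC h₀ hk₁)
    | gate k₁ =>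
    have hk : k₀ ≠ k₁ := fun h => hself a₀.rev (by rw [hk₁, h])
    cases hn : neg with
    | false =>
      rw [hn] at hdeg
      have hval : ∀ (x : Fin n → Bool) (w : Fin C.m → Bool), C.Consistent x w →
          C.nodeVal x w (C.arg k₀ a₀.rev) = C.nodeVal x w C.out := by
        intro x w hw
        rw [hout]
        show _ = w k₀
        rw [hw k₀, op_eq_liveFn h₀, hdeg, Bool.xor_false]
      refine ⟨ElimDataW.ofSetOut (v := C.arg k₀ a₀.rev)
        (elimDataWBypass (C := C.setOut (C.arg k₀ a₀.rev)) (k₀ := k₀) hF.setOut (hC.setOut hval)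
          ((C.isPacking_setOut_iff _ P).mpr hP) false h₀ hdeg (hself a₀.rev) hφ hI αQ) ?_, ?_⟩
      · show (if C.arg k₀ a₀.rev = .gate k₀ then C.arg k₀ a₀.rev else C.arg k₀ a₀.rev) =
          if C.out = .gate k₀ then C.arg k₀ a₀.rev else C.out
        rw [if_pos hout]; split_ifs <;> rfl
      · exact hk₁
    | true =>
      rw [hn] at hdeg
      let C₂ := C.flipGate k₁
      have hF₂ : C₂.Fair := hF.flipGate
      have hC₂ : C₂.ComputesRestr f R := hC.flipGate (by rw [hout]; exact fun h => hk (Node.gate.inj h))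
      have hP₂ : C₂.IsPacking P := (C.isPacking_flipGate_iff k₁ P).mpr hP
      have hdeg₂ : ∀ t, C₂.liveFn k₀ a₀ b t = (t ^^ false) := fun t => by
        rw [C.liveFn_flipGate hk h₀, hk₁, decide_eq_true rfl, hdeg]
        cases t <;> rfl
      have hval : ∀ (x : Fin n → Bool) (w : Fin C.m → Bool), C₂.Consistent x w →
          C₂.nodeVal x w (C₂.arg k₀ a₀.rev) = C₂.nodeVal x w C₂.out := by
        intro x w hw
        show C₂.nodeVal x w (C.arg k₀ a₀.rev) = C₂.nodeVal x w C.out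
        rw [hout]
        show _ = w k₀
        rw [hw k₀, op_eq_liveFn (C := C₂) h₀, hdeg₂, Bool.xor_false]
      refine ⟨ElimDataW.ofFlipGate (k₁ := k₁) (ElimDataW.ofSetOut (v := C.arg k₀ a₀.rev)
        (elimDataWBypass (C := C₂.setOut (C.arg k₀ a₀.rev)) (k₀ := k₀) hF₂.setOut (hC₂.setOut hval)
          ((C₂.isPacking_setOut_iff _ P).mpr hP₂) false h₀ hdeg₂ (hself a₀.rev) hφ hI αQ) ?_) hk, ?_⟩
      · show (if C.arg k₀ a₀.rev = .gate k₀ then C.arg k₀ a₀.rev else C.arg k₀ a₀.rev) =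
          if C.out = .gate k₀ then C.arg k₀ a₀.rev else C.out
        rw [if_pos hout]; split_ifs <;> rfl
      · exact hk₁
  · exact ⟨elimDataWBypass hF hC hP _ h₀ hdeg hout hφ hI αQ, rfl⟩

/-- Wires at complementary positions differ (no coinciding wires). [folklore] -/
theorem PreNormalized.arg_ne_arg_rev (hN : C.PreNormalized) (k : Fin C.m) (a : Fin 2) : C.arg k a ≠ C.arg k a.rev := by
  rcases fin2_eq_or_eq_rev 0 a with rfl | h
  · exact hN.arg_zero_ne_arg_one k
  · have ha : a = 1 := h
    subst ha
    exact fun h' => hN.arg_zero_ne_arg_one k h'.symm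

/-- **The dichotomy of Case 6 of the proof of Thm. 4.1** ("we try to substitute `x ← d` and
normalize the circuit. At least `P` will be eliminated by Rule 3. We now rule out all cases when
this operation does not give `Δμ = 1 + α_I + α_Q` … From now on, we assume that substituting
constant value to a protected variable will eliminate exactly one gate without introducing any
troubled ones"): under the standing assumptions with no ∧-type gate fed by two variables, for a
protected variable `x` (read by `P` at position `a`) and a constant `d`, either the one-step
conclusion holds outright (Cases 6.1, 6.2), or the bypass `E` of `P` in `C[x := d]` — an exact
elimination whose replacement node is the other wire of `P` — yields a circuit with no troubled
gate that is normalized (no constant wire, no coinciding wires, the only `0`-gate is the output,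
no useless gate), computing `f` on `assignProtected … d`, with `μ' + 1 + α_I + α_Q ≤ μ` at the
empty packings. [cite: LiYang2022, §4.1 (Case 6, Cases 6.1, 6.2), Lemma 3.11] -/
theorem protSubst_dichotomy (hf : IsAffineDisperser f d) (hd : 2 * d + 2 < R.dim) (hF : C.Fair)
    (hC : C.ComputesRestr f R) (hS : C.Standing R) (h2 : C.NoAndTwoVars)
    (hφ : 0 ≤ αφ) (hφ2 : αφ ≤ 1 / 2) (hI : 0 ≤ αI) (hQ : 0 ≤ αQ)
    {x : Fin n} {P : Fin C.m} {a : Fin 2} (hPx : C.arg P a = .var x)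
    {l : Fin n} {e : QuadEq n} (he : R.quad l = some e) (hxr : e.Reads x) (dd : ZMod 2) :
    C.StepGoal f R αφ αI αQ ∨
    ∃ E : ElimDataW (C.substConst x (finTwoEquiv dd)) P f (RdqSource.assignProtected he hxr dd) αφ αI αQ ∅ (1 - αφ),
      E.repl = C.arg P a.rev ∧ (∀ T, ¬ E.C'.Troubled T) ∧ E.C'.Normalized ∧
      E.C'.measure αφ αI αQ ∅ (RdqSource.assignProtected he hxr dd) + 1 + αI + αQ ≤ C.measure αφ αI αQ ∅ R := by
  classical
  have hN := hS.normalized.1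
  have hxp : R.Protected x := RdqSource.protected_of_reads he hxr
  obtain ⟨c₀, hc₀⟩ := hS.isXorOp_of_protected hxp hPx
  have hrx : C.arg P a.rev ≠ .var x := fun h => hN.arg_ne_arg_rev P a (hPx.trans h.symm)
  have hrc : ∀ b', C.arg P a.rev ≠ .const b' := fun b' h => hN.arg_ne_const P a.rev b' h
  have honly : ∀ k a', C.arg k a' = .var x → k = P := fun k a' h => hS.protected_one_reader x hxp k P a' a h hPx
  have hT0 : ∀ G, ¬ C.Troubled G := not_troubled_of_noAndTwoVars h2
  -- the substitution `x := d`
  let b : Bool := finTwoEquiv dd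
  let C₀ := C.substConst x b
  let R₁ := RdqSource.assignProtected he hxr dd
  have hF₀ : C₀.Fair := hF.substConst x b
  have hC₀ : C₀.ComputesRestr f R₁ := hC.substConst_assignProtected he hxr dd
  have hP₀ : C₀.IsPacking ∅ := C₀.isPacking_empty
  have hdim₁ : R₁.dim + 1 = R.dim := RdqSource.dim_assignProtected he hxr dd
  have hq₁ : R₁.quadCount + 1 = R.quadCount := RdqSource.quadCount_assignProtected he hxr dd
  have hd₁ : 2 * d + 2 ≤ R₁.dim := by
    have h1 : R₁.dim + 1 = R.dim := hdim₁
    omega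
  have h₀ : C₀.arg P a = .const b := by
    show (C.arg P a).substConst x b = _; rw [hPx, Node.substConst_var_self]
  have harg₀ : ∀ (k : Fin C.m) (a' : Fin 2), C.arg k a' ≠ .var x → C₀.arg k a' = C.arg k a' :=
    fun k a' hk => Node.substConst_of_ne hk b
  have hr₀ : C₀.arg P a.rev = C.arg P a.rev := harg₀ P a.rev hrx
  have hargK : ∀ (k : Fin C.m) (a' : Fin 2), k ≠ P → C₀.arg k a' = C.arg k a' :=
    fun k a' hk => harg₀ k a' fun h => hk (honly k a' h)
  have hdeg : ∀ t, C₀.liveFn P a b t = (t ^^ (b ^^ c₀)) := by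
    intro t
    have e1 : ∀ p q c : Bool, ((p ^^ q) ^^ c) = (q ^^ (p ^^ c)) := by decide
    have e2 : ∀ p q c : Bool, ((q ^^ p) ^^ c) = (q ^^ (p ^^ c)) := by decide
    unfold liveFn
    show (if a = 0 then C.op P b t else C.op P t b) = _
    split_ifs
    · rw [hc₀]; exact e1 b t c₀
    · rw [hc₀]; exact e2 b t c₀
  obtain ⟨E, hrepl₀⟩ := exists_elimDataW_degen hf hd₁ hF₀ hC₀ hP₀ h₀ hdeg hφ hI αQ
  have hrepl : E.repl = C.arg P a.rev := hrepl₀.trans hr₀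
  -- no troubled gate in `C`, `C₀`; potentials vanish at the empty packing
  have hT₀ : ∀ G, ¬ C₀.Troubled G := fun G h => hT0 G (C.troubled_of_troubled_substConst h)
  have hpotC : C.potential ∅ = 0 := by
    have : C.troubledCount = 0 := by
      unfold troubledCount; rw [card_eq_zero, filter_eq_empty_iff]; exact fun G _ => hT0 G
    unfold potential; rw [this]; simp
  have hpot₀ : C₀.potential ∅ = 0 := by
    have : C₀.troubledCount = 0 := by
      unfold troubledCount; rw [card_eq_zero, filter_eq_empty_iff]; exact fun G _ => hT₀ G
    unfold potential; rw [this]; simp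
  -- accounting of the substitution: `x` is no longer influential, one quadratic equation is killed
  have hxinf : x ∈ C.influential R := C.mem_influential_of_reads R hPx
  have hinf₀ : ((C₀.influential R₁).card : ℝ) + 1 ≤ (C.influential R).card := by
    have h1 := C.influential_substConst_assignProtected_subset he hxr dd b
    have h2' : C₀.influential R₁ ⊆ (C.influential R).erase x := fun i hi => (mem_filter.mp (h1 hi)).1
    have h3 := card_le_card h2'
    have h4 := card_erase_add_one hxinf
    have : (C₀.influential R₁).card + 1 ≤ (C.influential R).card := by omega
    exact_mod_cast this
  have hμ₀ : C₀.measure αφ αI αQ ∅ R₁ ≤ C.measure αφ αI αQ ∅ R - αI - αQ := by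
    have hq' : ((R.quadCount : ℕ) : ℝ) = R₁.quadCount + 1 := by exact_mod_cast hq₁.symm
    have hm : ((C₀.m : ℕ) : ℝ) = C.m := rfl
    unfold measure
    rw [hpotC, hpot₀, hq', hm]
    nlinarith [mul_le_mul_of_nonneg_left hinf₀ hI]
  have hμE := E.measure_le
  have hδ := liYangDelta_le_case1 αφ αI αQ
  -- Case 6.1, Rule 5: a gate with coinciding wires (a reader of `P` that also read its other wire)
  by_cases hco : ∃ k, E.C'.arg k 0 = E.C'.arg k 1
  · left
    obtain ⟨k, hk⟩ := hco
    obtain ⟨C', P', hF', hC', hP', -, hμ'⟩ : ∃ (C' : Semicircuit n) (P' : Finset (Fin C'.m × Fin C'.m)),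
        C'.Fair ∧ C'.ComputesRestr f R₁ ∧ C'.IsPacking P' ∧ C'.m + 1 = E.C'.m ∧
        C'.measure αφ αI αQ P' R₁ ≤ E.C'.measure αφ αI αQ E.P' R₁ - (1 - αφ) := by
      by_cases hself : E.C'.arg k 0 = .gate k
      · have h1 : E.C'.arg k 1 = .gate k := hk.symm.trans hself
        exact rule_selfTwice E.fair E.computes E.packing hself h1
          (out_ne_of_selfTwice hf (by omega) E.fair E.computes hself h1) hφ hI αQ
      · exact rule5_any hf hd₁ E.fair E.computes E.packing hk hself hφ hI αQ
    refine Or.inr ⟨1, le_rfl, by norm_num, C', R₁, P', hF', hC', hP', hdim₁, ?_⟩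
    simp only [Nat.cast_one, mul_one]
    linarith
  -- the new circuit is pre-normalized
  have hKc : ∀ k a' b', E.C'.arg k a' ≠ .const b' := by
    intro k a' b' h
    rcases (E.arg_eq_const_iff k a' b').mp h with h | ⟨-, h⟩
    · rw [hargK (E.ι k) a' (E.ι_ne k)] at h
      exact hN.arg_ne_const _ _ _ h
    · rw [hrepl] at h; exact hrc b' h
  have hK0 : ∀ k, E.C'.fanout (.gate k) = 0 → E.C'.out = .gate k := by
    intro k hk0
    have hout_of : C.out = .gate (E.ι k) ∨ (C.out = .gate P ∧ E.repl = .gate (E.ι k)) → E.C'.out = .gate k := by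
      intro hh
      apply E.embed_injective
      show E.C'.out.embed E.ι = (Node.gate k : Node n E.C'.m).embed E.ι
      rw [E.out_eq]
      show (if C₀.out = .gate P then E.repl else C₀.out) = .gate (E.ι k)
      have hCo : C₀.out = C.out.substConst x b := rfl
      rcases hh with hh | ⟨hh, hr'⟩
      · rw [hCo, hh, Node.substConst_gate, if_neg (fun h' => E.ι_ne k (Node.gate.inj h'))]
      · rw [hCo, hh, Node.substConst_gate, if_pos rfl]; exact hr'
    by_cases hrk : E.repl = .gate (E.ι k)
    · -- `k` is the other wire of `P`
      have h := E.fanout_repl_add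
      rw [hrk, E.pull_ι] at h
      have hc1 : (univ.filter fun a' : Fin 2 => C₀.arg P a' = .gate (E.ι k)).card = 1 := by
        rw [card_eq_one]
        refine ⟨a.rev, ?_⟩
        ext a'
        simp only [mem_filter, mem_univ, true_and, mem_singleton]
        constructor
        · intro h'
          rcases fin2_eq_or_eq_rev a a' with rfl | rfl
          · rw [h₀] at h'; cases h'
          · rfl
        · rintro rfl; rw [hr₀, ← hrepl]; exact hrk
      rw [hc1, hk0] at h
      have hfr : 1 ≤ C₀.fanout (.gate (E.ι k)) := one_le_fanout_of_arg_eq (hr₀.trans (hrepl.symm.trans hrk))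
      have hfP : C₀.fanout (.gate P) = 0 := by omega
      have hfP' : C.fanout (.gate P) = 0 := by rw [← C.fanout_substConst_gate]; exact hfP
      exact hout_of (Or.inr ⟨hN.out_of_fanout_eq_zero P hfP', hrk⟩)
    · have h := E.fanout_gate_add hrk
      have hc0 : (univ.filter fun a' : Fin 2 => C₀.arg P a' = .gate (E.ι k)).card = 0 := by
        rw [card_eq_zero, filter_eq_empty_iff]
        intro a' _ h'
        rcases fin2_eq_or_eq_rev a a' with rfl | rfl
        · rw [h₀] at h'; cases h'
        · rw [hr₀, ← hrepl] at h'; exact hrk h'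
      rw [hc0, hk0] at h
      have hf0' : C₀.fanout (.gate (E.ι k)) = 0 := by omega
      have hf0 : C.fanout (.gate (E.ι k)) = 0 := by rw [← C.fanout_substConst_gate x b]; exact hf0'
      exact hout_of (Or.inl (hN.out_of_fanout_eq_zero _ hf0))
  have hNK : E.C'.PreNormalized := ⟨hK0, hKc, fun k h => hco ⟨k, h⟩⟩
  -- Case 6.1, Rule 4: a useless gate
  by_cases hus : ∃ G, E.C'.Useless G
  · left
    obtain ⟨G, hG⟩ := hus
    have houtG := out_ne_gate_of_useless hf (by omega : 2 * d + 1 ≤ R₁.dim) E.fair E.computes hNK hG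
    obtain ⟨hG1, Q', aQ, aG, hGQ, hQG, hshare⟩ := hG
    obtain ⟨C', P', hF', hC', hP', -, hμ'⟩ := rule4_sharp (C := E.C') (Q := Q') hG1 hQG (Ne.symm hGQ) hshare
      (hNK.arg_zero_ne_arg_one G) E.fair E.computes E.packing houtG hφ hI αQ
    refine Or.inr ⟨1, le_rfl, by norm_num, C', R₁, P', hF', hC', hP', hdim₁, ?_⟩
    simp only [Nat.cast_one, mul_one]
    linarith
  -- Case 6.2: a troubled gate — then `P` reads a variable `u` and an ∧-type reader `B` of `P` reads a variable `t`
  by_cases htr : ∃ T, E.C'.Troubled T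
  · left
    obtain ⟨T, hT⟩ := htr
    obtain ⟨aT, u, t, hTP, hru, hTu, hTt, -, -⟩ := E.exists_of_troubled_noAndTwoVars (h2.substConst x b) hT
    have hBP' : E.ι T ≠ P := E.ι_ne T
    have hBP : C.arg (E.ι T) aT = .gate P := by rw [← hargK _ aT hBP']; exact hTP
    have hBt : C.arg (E.ι T) aT.rev = .var t := by rw [← hargK _ aT.rev hBP']; exact hTt
    have hBand : IsAndOp (C.op (E.ι T)) := (E.isAndOp_iff T).mp hT.1
    have hPu : C.arg P a.rev = .var u := hrepl.symm.trans hru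
    have hux : u ≠ x := fun h => hrx (by rw [hPu, h])
    obtain ⟨-, -, -, -, -, h2u, -⟩ := Troubled.exists_wires_of_reads hT ⟨aT, hTu⟩
    have h := E.fanout_repl_add
    rw [hru, E.pull_var] at h
    have hc1 : (univ.filter fun a' : Fin 2 => C₀.arg P a' = .var u).card = 1 := by
      rw [card_eq_one]
      refine ⟨a.rev, ?_⟩
      ext a'
      simp only [mem_filter, mem_univ, true_and, mem_singleton]
      constructor
      · intro h'
        rcases fin2_eq_or_eq_rev a a' with rfl | rfl
        · rw [h₀] at h'; cases h'
        · rfl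
      · rintro rfl; rw [hr₀]; exact hPu
    rw [hc1, h2u] at h
    have hfu : C₀.fanout (.var u) = C.fanout (.var u) := C.fanout_substConst_var_of_ne _ _ hux
    have hfP : C₀.fanout (.gate P) = C.fanout (.gate P) := C.fanout_substConst_gate _ _ P
    rw [hfu, hfP] at h
    have hu1' : 1 ≤ C.fanout (.var u) := one_le_fanout_of_arg_eq hPu
    -- `fanout u + fanout P = 3`
    rcases Nat.lt_or_ge (C.fanout (.gate P)) 1 with hP0 | hP1
    · -- `P` is the output, reading a live variable: impossible
      exfalso
      have hoP : C.out = .gate P := hN.out_of_fanout_eq_zero P (by omega)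
      have hoP₀ : C₀.out = .gate P := by show C.out.substConst x b = _; rw [hoP]; rfl
      exact out_ne_of_live_var hf hd₁ hF₀ hC₀ h₀ (hr₀.trans hPu) hoP₀
    · rcases Nat.lt_or_ge (C.fanout (.gate P)) 2 with hP1' | hP2
      · exact case6_2_2_4 hf hd hF hC hS hφ hφ2 hI hQ hPx hxp (by omega) hBand hBP hBt
      · exact case6_2_2_oneVar hf hd hF hC hS hφ hφ2 hI hQ hPx hPu hxp (by omega)
  -- the good branch
  right
  refine ⟨E, hrepl, fun T hT => htr ⟨T, hT⟩, ⟨hNK, fun G hG => hus ⟨G, hG⟩⟩, ?_⟩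
  have hpotK : E.C'.potential ∅ = 0 := by
    have : E.C'.troubledCount = 0 := by
      unfold troubledCount; rw [card_eq_zero, filter_eq_empty_iff]; exact fun T _ hT => htr ⟨T, hT⟩
    unfold potential; rw [this]; simp
  have hinfK : ((E.C'.influential R₁).card : ℝ) ≤ (C₀.influential R₁).card := by
    exact_mod_cast card_le_card (E.influential_subset R₁)
  have hmK : ((E.C'.m : ℕ) : ℝ) + 1 = C.m := by exact_mod_cast E.m_add_one
  have hq' : ((R.quadCount : ℕ) : ℝ) = R₁.quadCount + 1 := by exact_mod_cast hq₁.symm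
  show E.C'.measure αφ αI αQ ∅ R₁ + 1 + αI + αQ ≤ C.measure αφ αI αQ ∅ R
  unfold measure
  rw [hpotK, hpotC, hq']
  nlinarith [mul_le_mul_of_nonneg_left hinf₀ hI, mul_le_mul_of_nonneg_left hinfK hI]

/-! ### Semantics of the bypass; the dichotomy for a given bypass -/

/-- **The bypass elimination restricts solutions** along its embedding (gate values are
unchanged; the readers of the bypassed gate have their functions adjusted). [folklore] -/
theorem elimDataWBypass_consistent (hF : C.Fair) (hC : C.ComputesRestr f R)
    {P : Finset (Fin C.m × Fin C.m)} (hP : C.IsPacking P) {k₀ : Fin C.m} {a₀ : Fin 2} {b₀ : Bool} (neg : Bool)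
    (h₀ : C.arg k₀ a₀ = .const b₀) (hdeg : ∀ t, C.liveFn k₀ a₀ b₀ t = (t ^^ neg)) (hout : C.out ≠ .gate k₀)
    (hφ : 0 ≤ αφ) (hI : 0 ≤ αI) (αQ : ℝ) {xx : Fin n → Bool} {w : Fin C.m → Bool} (hw : C.Consistent xx w) :
    (elimDataWBypass hF hC hP neg h₀ hdeg hout hφ hI αQ).C'.Consistent xx
      (fun k' => w ((elimDataWBypass hF hC hP neg h₀ hdeg hout hφ hI αQ).ι k')) := by
  have hself := hF.not_reads_self_of_const h₀
  have hid : ∀ (x : Fin n → Bool) (w : Fin C.m → Bool),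
      C.op k₀ (C.nodeVal x w (C.arg k₀ 0)) (C.nodeVal x w (C.arg k₀ 1)) = (C.nodeVal x w (C.arg k₀ a₀.rev) ^^ neg) := by
    intro x w; rw [op_eq_liveFn h₀, hdeg]
  have h0₁ := C.not_reads_redirect_live (k₀ := k₀) (a₀ := a₀) neg (hself _)
  show (C.bypass k₀ a₀ neg (C.skipEquiv k₀)).Consistent xx (fun k' => w (C.skipEquiv k₀ k'))
  exact Consistent.removeGate (C := C.redirect k₀ (C.arg k₀ a₀.rev) neg (C.redirectOK_live k₀ a₀)) (C.skipEquiv k₀) h0₁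
    ((C.consistent_redirect_iff k₀ _ neg _ hself hid xx w).mpr hw)

/-- `flipVals` is xoring with the indicator of the flipped gate. [folklore] -/
theorem flipVals_eq_xor (k₁ : Fin C.m) (w : Fin C.m → Bool) (k : Fin C.m) : C.flipVals k₁ w k = (w k ^^ decide (k = k₁)) := by
  unfold flipVals
  by_cases h : k = k₁
  · subst h; simp
  · rw [Function.update_of_ne h, decide_eq_false h, Bool.xor_false]

/-- **Exact elimination data for a degenerate gate fed by a constant, with known replacement and
semantics**: as `exists_elimDataW_degen`, and the solutions of `C` restrict to solutions of the
new circuit up to a fixed pattern of negations (the live gate is flipped when it becomes the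
output of a negating bypass). [cite: LiYang2022, §3.3 (Rule 3), Lemma 3.11] -/
theorem exists_elimDataW_degen_sem (hf : IsAffineDisperser f d) (hd : 2 * d + 2 ≤ R.dim) (hF : C.Fair)
    (hC : C.ComputesRestr f R) {P : Finset (Fin C.m × Fin C.m)} (hP : C.IsPacking P)
    {k₀ : Fin C.m} {a₀ : Fin 2} {b : Bool} (h₀ : C.arg k₀ a₀ = .const b) {neg : Bool}
    (hdeg : ∀ t, C.liveFn k₀ a₀ b t = (t ^^ neg)) (hφ : 0 ≤ αφ) (hI : 0 ≤ αI) (αQ : ℝ) :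
    ∃ E : ElimDataW C k₀ f R αφ αI αQ P (1 - αφ), E.repl = C.arg k₀ a₀.rev ∧
      ∃ σ : Fin C.m → Bool, ∀ (xx : Fin n → Bool) (w : Fin C.m → Bool), C.Consistent xx w →
        E.C'.Consistent xx (fun k' => (w (E.ι k') ^^ σ (E.ι k'))) := by
  have hself := hF.not_reads_self_of_const h₀
  have hx0 : ∀ (D : Semicircuit n) (g : Fin D.m → Fin C.m) (w : Fin C.m → Bool),
      (fun k' => (w (g k') ^^ (fun _ : Fin C.m => false) (g k'))) = fun k' => w (g k') :=
    fun D g w => funext fun _ => Bool.xor_false _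
  by_cases hout : C.out = .gate k₀
  · cases hk₁ : C.arg k₀ a₀.rev with
    | const b' => exact absurd hout (out_ne_of_const_const hf (by omega) hF hC h₀ hk₁)
    | var i => exact absurd hout (out_ne_of_live_var hf hd hF hC h₀ hk₁)
    | gate k₁ =>
    have hk : k₀ ≠ k₁ := fun h => hself a₀.rev (by rw [hk₁, h])
    cases hn : neg with
    | false =>
      rw [hn] at hdeg
      have hval : ∀ (x : Fin n → Bool) (w : Fin C.m → Bool), C.Consistent x w →
          C.nodeVal x w (C.arg k₀ a₀.rev) = C.nodeVal x w C.out := by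
        intro x w hw
        rw [hout]
        show _ = w k₀
        rw [hw k₀, op_eq_liveFn h₀, hdeg, Bool.xor_false]
      refine ⟨ElimDataW.ofSetOut (v := C.arg k₀ a₀.rev)
        (elimDataWBypass (C := C.setOut (C.arg k₀ a₀.rev)) (k₀ := k₀) hF.setOut (hC.setOut hval)
          ((C.isPacking_setOut_iff _ P).mpr hP) false h₀ hdeg (hself a₀.rev) hφ hI αQ) ?_, ?_, fun _ => false, ?_⟩
      · show (if C.arg k₀ a₀.rev = .gate k₀ then C.arg k₀ a₀.rev else C.arg k₀ a₀.rev) =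
          if C.out = .gate k₀ then C.arg k₀ a₀.rev else C.out
        rw [if_pos hout]; split_ifs <;> rfl
      · exact hk₁
      · intro xx w hw
        rw [hx0]
        exact elimDataWBypass_consistent (C := C.setOut (C.arg k₀ a₀.rev)) hF.setOut (hC.setOut hval)
          ((C.isPacking_setOut_iff _ P).mpr hP) false h₀ hdeg (hself a₀.rev) hφ hI αQ
          ((C.consistent_setOut_iff _ xx w).mpr hw)
    | true =>
      rw [hn] at hdeg
      let C₂ := C.flipGate k₁
      have hF₂ : C₂.Fair := hF.flipGate
      have hC₂ : C₂.ComputesRestr f R := hC.flipGate (by rw [hout]; exact fun h => hk (Node.gate.inj h))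
      have hP₂ : C₂.IsPacking P := (C.isPacking_flipGate_iff k₁ P).mpr hP
      have hdeg₂ : ∀ t, C₂.liveFn k₀ a₀ b t = (t ^^ false) := fun t => by
        rw [C.liveFn_flipGate hk h₀, hk₁, decide_eq_true rfl, hdeg]
        cases t <;> rfl
      have hval : ∀ (x : Fin n → Bool) (w : Fin C.m → Bool), C₂.Consistent x w →
          C₂.nodeVal x w (C₂.arg k₀ a₀.rev) = C₂.nodeVal x w C₂.out := by
        intro x w hw
        show C₂.nodeVal x w (C.arg k₀ a₀.rev) = C₂.nodeVal x w C.out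
        rw [hout]
        show _ = w k₀
        rw [hw k₀, op_eq_liveFn (C := C₂) h₀, hdeg₂, Bool.xor_false]
      refine ⟨ElimDataW.ofFlipGate (k₁ := k₁) (ElimDataW.ofSetOut (v := C.arg k₀ a₀.rev)
        (elimDataWBypass (C := C₂.setOut (C.arg k₀ a₀.rev)) (k₀ := k₀) hF₂.setOut (hC₂.setOut hval)
          ((C₂.isPacking_setOut_iff _ P).mpr hP₂) false h₀ hdeg₂ (hself a₀.rev) hφ hI αQ) ?_) hk, ?_,
          fun k => decide (k = k₁), ?_⟩
      · show (if C.arg k₀ a₀.rev = .gate k₀ then C.arg k₀ a₀.rev else C.arg k₀ a₀.rev) =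
          if C.out = .gate k₀ then C.arg k₀ a₀.rev else C.out
        rw [if_pos hout]; split_ifs <;> rfl
      · exact hk₁
      · intro xx w hw
        have hw₂ : C₂.Consistent xx (C.flipVals k₁ w) := by
          rw [C.consistent_flipGate_iff]; simpa using hw
        have key := elimDataWBypass_consistent (C := C₂.setOut (C.arg k₀ a₀.rev)) hF₂.setOut (hC₂.setOut hval)
          ((C₂.isPacking_setOut_iff _ P).mpr hP₂) false h₀ hdeg₂ (hself a₀.rev) hφ hI αQ
          ((C₂.consistent_setOut_iff _ xx (C.flipVals k₁ w)).mpr hw₂)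
        have e : (fun k' => (w ((elimDataWBypass (C := C₂.setOut (C.arg k₀ a₀.rev)) (k₀ := k₀) hF₂.setOut (hC₂.setOut hval)
            ((C₂.isPacking_setOut_iff _ P).mpr hP₂) false h₀ hdeg₂ (hself a₀.rev) hφ hI αQ).ι k') ^^
            decide ((elimDataWBypass (C := C₂.setOut (C.arg k₀ a₀.rev)) (k₀ := k₀) hF₂.setOut (hC₂.setOut hval)
            ((C₂.isPacking_setOut_iff _ P).mpr hP₂) false h₀ hdeg₂ (hself a₀.rev) hφ hI αQ).ι k' = k₁))) =
            fun k' => C.flipVals k₁ w ((elimDataWBypass (C := C₂.setOut (C.arg k₀ a₀.rev)) (k₀ := k₀) hF₂.setOut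
              (hC₂.setOut hval) ((C₂.isPacking_setOut_iff _ P).mpr hP₂) false h₀ hdeg₂ (hself a₀.rev) hφ hI αQ).ι k') :=
          funext fun k' => (C.flipVals_eq_xor k₁ w _).symm
        exact e ▸ key
  · refine ⟨elimDataWBypass hF hC hP _ h₀ hdeg hout hφ hI αQ, rfl, fun _ => false, fun xx w hw => ?_⟩
    rw [hx0]
    exact elimDataWBypass_consistent hF hC hP _ h₀ hdeg hout hφ hI αQ hw

/-- **The dichotomy of Case 6 for a given bypass** of `P` in `C[x := d]` (an exact elimination
whose replacement node is the other wire of `P`): the analysis of `protSubst_dichotomy`.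
[cite: LiYang2022, §4.1 (Case 6, Cases 6.1, 6.2), Lemma 3.11] -/
theorem protSubst_dichotomy_of (hf : IsAffineDisperser f d) (hd : 2 * d + 2 < R.dim) (hF : C.Fair)
    (hC : C.ComputesRestr f R) (hS : C.Standing R) (h2 : C.NoAndTwoVars)
    (hφ : 0 ≤ αφ) (hφ2 : αφ ≤ 1 / 2) (hI : 0 ≤ αI) (hQ : 0 ≤ αQ)
    {x : Fin n} {P : Fin C.m} {a : Fin 2} (hPx : C.arg P a = .var x)
    {l : Fin n} {e : QuadEq n} (he : R.quad l = some e) (hxr : e.Reads x) (dd : ZMod 2)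
    (E : ElimDataW (C.substConst x (finTwoEquiv dd)) P f (RdqSource.assignProtected he hxr dd) αφ αI αQ ∅ (1 - αφ))
    (hrepl : E.repl = C.arg P a.rev) :
    C.StepGoal f R αφ αI αQ ∨
    ((∀ T, ¬ E.C'.Troubled T) ∧ E.C'.Normalized ∧
      E.C'.measure αφ αI αQ ∅ (RdqSource.assignProtected he hxr dd) + 1 + αI + αQ ≤ C.measure αφ αI αQ ∅ R) := by
  classical
  have hN := hS.normalized.1
  have hxp : R.Protected x := RdqSource.protected_of_reads he hxr
  have hrx : C.arg P a.rev ≠ .var x := fun h => hN.arg_ne_arg_rev P a (hPx.trans h.symm)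
  have hrc : ∀ b', C.arg P a.rev ≠ .const b' := fun b' h => hN.arg_ne_const P a.rev b' h
  have honly : ∀ k a', C.arg k a' = .var x → k = P := fun k a' h => hS.protected_one_reader x hxp k P a' a h hPx
  have hT0 : ∀ G, ¬ C.Troubled G := not_troubled_of_noAndTwoVars h2
  -- the substitution `x := d`
  have hF₀ : (C.substConst x (finTwoEquiv dd)).Fair := hF.substConst x (finTwoEquiv dd)
  have hC₀ : (C.substConst x (finTwoEquiv dd)).ComputesRestr f (RdqSource.assignProtected he hxr dd) := hC.substConst_assignProtected he hxr dd
  have hP₀ : (C.substConst x (finTwoEquiv dd)).IsPacking ∅ := (C.substConst x (finTwoEquiv dd)).isPacking_empty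
  have hdim₁ : (RdqSource.assignProtected he hxr dd).dim + 1 = R.dim := RdqSource.dim_assignProtected he hxr dd
  have hq₁ : (RdqSource.assignProtected he hxr dd).quadCount + 1 = R.quadCount := RdqSource.quadCount_assignProtected he hxr dd
  have hd₁ : 2 * d + 2 ≤ (RdqSource.assignProtected he hxr dd).dim := by
    have h1 : (RdqSource.assignProtected he hxr dd).dim + 1 = R.dim := hdim₁
    omega
  have h₀ : (C.substConst x (finTwoEquiv dd)).arg P a = .const (finTwoEquiv dd) := by
    show (C.arg P a).substConst x (finTwoEquiv dd) = _; rw [hPx, Node.substConst_var_self]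
  have harg₀ : ∀ (k : Fin C.m) (a' : Fin 2), C.arg k a' ≠ .var x → (C.substConst x (finTwoEquiv dd)).arg k a' = C.arg k a' :=
    fun k a' hk => Node.substConst_of_ne hk (finTwoEquiv dd)
  have hr₀ : (C.substConst x (finTwoEquiv dd)).arg P a.rev = C.arg P a.rev := harg₀ P a.rev hrx
  have h₀' : Node.substConst x (finTwoEquiv dd) (C.arg P a) = .const (finTwoEquiv dd) := h₀
  have hr₀' : Node.substConst x (finTwoEquiv dd) (C.arg P a.rev) = C.arg P a.rev := hr₀
  have hargK : ∀ (k : Fin C.m) (a' : Fin 2), k ≠ P → (C.substConst x (finTwoEquiv dd)).arg k a' = C.arg k a' :=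
    fun k a' hk => harg₀ k a' fun h => hk (honly k a' h)
  -- no troubled gate in `C`, `(C.substConst x (finTwoEquiv dd))`; potentials vanish at the empty packing
  have hT₀ : ∀ G, ¬ (C.substConst x (finTwoEquiv dd)).Troubled G := fun G h => hT0 G (C.troubled_of_troubled_substConst h)
  have hpotC : C.potential ∅ = 0 := by
    have : C.troubledCount = 0 := by
      unfold troubledCount; rw [card_eq_zero, filter_eq_empty_iff]; exact fun G _ => hT0 G
    unfold potential; rw [this]; simp
  have hpot₀ : (C.substConst x (finTwoEquiv dd)).potential ∅ = 0 := by
    have : (C.substConst x (finTwoEquiv dd)).troubledCount = 0 := by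
      unfold troubledCount; rw [card_eq_zero, filter_eq_empty_iff]; exact fun G _ => hT₀ G
    unfold potential; rw [this]; simp
  -- accounting of the substitution: `x` is no longer influential, one quadratic equation is killed
  have hxinf : x ∈ C.influential R := C.mem_influential_of_reads R hPx
  have hinf₀ : (((C.substConst x (finTwoEquiv dd)).influential (RdqSource.assignProtected he hxr dd)).card : ℝ) + 1 ≤ (C.influential R).card := by
    have h1 := C.influential_substConst_assignProtected_subset he hxr dd (finTwoEquiv dd)
    have h2' : (C.substConst x (finTwoEquiv dd)).influential (RdqSource.assignProtected he hxr dd) ⊆ (C.influential R).erase x := fun i hi => (mem_filter.mp (h1 hi)).1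
    have h3 := card_le_card h2'
    have h4 := card_erase_add_one hxinf
    have : ((C.substConst x (finTwoEquiv dd)).influential (RdqSource.assignProtected he hxr dd)).card + 1 ≤ (C.influential R).card := by omega
    exact_mod_cast this
  have hμ₀ : (C.substConst x (finTwoEquiv dd)).measure αφ αI αQ ∅ (RdqSource.assignProtected he hxr dd) ≤ C.measure αφ αI αQ ∅ R - αI - αQ := by
    have hq' : ((R.quadCount : ℕ) : ℝ) = (RdqSource.assignProtected he hxr dd).quadCount + 1 := by exact_mod_cast hq₁.symm
    have hm : (((C.substConst x (finTwoEquiv dd)).m : ℕ) : ℝ) = C.m := rfl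
    unfold measure
    rw [hpotC, hpot₀, hq', hm]
    nlinarith [mul_le_mul_of_nonneg_left hinf₀ hI]
  have hμE := E.measure_le
  have hδ := liYangDelta_le_case1 αφ αI αQ
  -- Case 6.1, Rule 5: a gate with coinciding wires (a reader of `P` that also read its other wire)
  by_cases hco : ∃ k, E.C'.arg k 0 = E.C'.arg k 1
  · left
    obtain ⟨k, hk⟩ := hco
    obtain ⟨C', P', hF', hC', hP', -, hμ'⟩ : ∃ (C' : Semicircuit n) (P' : Finset (Fin C'.m × Fin C'.m)),
        C'.Fair ∧ C'.ComputesRestr f (RdqSource.assignProtected he hxr dd) ∧ C'.IsPacking P' ∧ C'.m + 1 = E.C'.m ∧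
        C'.measure αφ αI αQ P' (RdqSource.assignProtected he hxr dd) ≤ E.C'.measure αφ αI αQ E.P' (RdqSource.assignProtected he hxr dd) - (1 - αφ) := by
      by_cases hself : E.C'.arg k 0 = .gate k
      · have h1 : E.C'.arg k 1 = .gate k := hk.symm.trans hself
        exact rule_selfTwice E.fair E.computes E.packing hself h1
          (out_ne_of_selfTwice hf (by omega) E.fair E.computes hself h1) hφ hI αQ
      · exact rule5_any hf hd₁ E.fair E.computes E.packing hk hself hφ hI αQ
    refine Or.inr ⟨1, le_rfl, by norm_num, C', (RdqSource.assignProtected he hxr dd), P', hF', hC', hP', hdim₁, ?_⟩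
    simp only [Nat.cast_one, mul_one]
    linarith
  -- the new circuit is pre-normalized
  have hKc : ∀ k a' b', E.C'.arg k a' ≠ .const b' := by
    intro k a' b' h
    rcases (E.arg_eq_const_iff k a' b').mp h with h | ⟨-, h⟩
    · rw [hargK (E.ι k) a' (E.ι_ne k)] at h
      exact hN.arg_ne_const _ _ _ h
    · rw [hrepl] at h; exact hrc b' h
  have hK0 : ∀ k, E.C'.fanout (.gate k) = 0 → E.C'.out = .gate k := by
    intro k hk0
    have hout_of : C.out = .gate (E.ι k) ∨ (C.out = .gate P ∧ E.repl = .gate (E.ι k)) → E.C'.out = .gate k := by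
      intro hh
      apply E.embed_injective
      show E.C'.out.embed E.ι = (Node.gate k : Node n E.C'.m).embed E.ι
      rw [E.out_eq]
      show (if (C.substConst x (finTwoEquiv dd)).out = .gate P then E.repl else (C.substConst x (finTwoEquiv dd)).out) = .gate (E.ι k)
      have hCo : (C.substConst x (finTwoEquiv dd)).out = C.out.substConst x (finTwoEquiv dd) := rfl
      rcases hh with hh | ⟨hh, hr'⟩
      · rw [hCo, hh, Node.substConst_gate, if_neg (fun h' => E.ι_ne k (Node.gate.inj h'))]
      · rw [hCo, hh, Node.substConst_gate, if_pos rfl]; exact hr'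
    by_cases hrk : E.repl = .gate (E.ι k)
    · -- `k` is the other wire of `P`
      have h := E.fanout_repl_add
      rw [hrk, E.pull_ι] at h
      have hc1 : (univ.filter fun a' : Fin 2 => (C.substConst x (finTwoEquiv dd)).arg P a' = .gate (E.ι k)).card = 1 := by
        rw [card_eq_one]
        refine ⟨a.rev, ?_⟩
        ext a'
        simp only [mem_filter, mem_univ, true_and, mem_singleton]
        constructor
        · intro h'
          rcases fin2_eq_or_eq_rev a a' with rfl | rfl
          · rw [h₀'] at h'; cases h'
          · rfl
        · rintro rfl; rw [hr₀', ← hrepl]; exact hrk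
      rw [hc1, hk0] at h
      have hfr : 1 ≤ (C.substConst x (finTwoEquiv dd)).fanout (.gate (E.ι k)) := one_le_fanout_of_arg_eq (hr₀.trans (hrepl.symm.trans hrk))
      have hfP : (C.substConst x (finTwoEquiv dd)).fanout (.gate P) = 0 := by omega
      have hfP' : C.fanout (.gate P) = 0 := by rw [← C.fanout_substConst_gate]; exact hfP
      exact hout_of (Or.inr ⟨hN.out_of_fanout_eq_zero P hfP', hrk⟩)
    · have h := E.fanout_gate_add hrk
      have hc0 : (univ.filter fun a' : Fin 2 => (C.substConst x (finTwoEquiv dd)).arg P a' = .gate (E.ι k)).card = 0 := by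
        rw [card_eq_zero, filter_eq_empty_iff]
        intro a' _ h'
        rcases fin2_eq_or_eq_rev a a' with rfl | rfl
        · rw [h₀] at h'; cases h'
        · rw [hr₀, ← hrepl] at h'; exact hrk h'
      rw [hc0, hk0] at h
      have hf0' : (C.substConst x (finTwoEquiv dd)).fanout (.gate (E.ι k)) = 0 := by omega
      have hf0 : C.fanout (.gate (E.ι k)) = 0 := by rw [← C.fanout_substConst_gate x (finTwoEquiv dd)]; exact hf0'
      exact hout_of (Or.inl (hN.out_of_fanout_eq_zero _ hf0))
  have hNK : E.C'.PreNormalized := ⟨hK0, hKc, fun k h => hco ⟨k, h⟩⟩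
  -- Case 6.1, Rule 4: a useless gate
  by_cases hus : ∃ G, E.C'.Useless G
  · left
    obtain ⟨G, hG⟩ := hus
    have houtG := out_ne_gate_of_useless hf (by omega : 2 * d + 1 ≤ (RdqSource.assignProtected he hxr dd).dim) E.fair E.computes hNK hG
    obtain ⟨hG1, Q', aQ, aG, hGQ, hQG, hshare⟩ := hG
    obtain ⟨C', P', hF', hC', hP', -, hμ'⟩ := rule4_sharp (C := E.C') (Q := Q') hG1 hQG (Ne.symm hGQ) hshare
      (hNK.arg_zero_ne_arg_one G) E.fair E.computes E.packing houtG hφ hI αQ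
    refine Or.inr ⟨1, le_rfl, by norm_num, C', (RdqSource.assignProtected he hxr dd), P', hF', hC', hP', hdim₁, ?_⟩
    simp only [Nat.cast_one, mul_one]
    linarith
  -- Case 6.2: a troubled gate — then `P` reads a variable `u` and an ∧-type reader `B` of `P` reads a variable `t`
  by_cases htr : ∃ T, E.C'.Troubled T
  · left
    obtain ⟨T, hT⟩ := htr
    obtain ⟨aT, u, t, hTP, hru, hTu, hTt, -, -⟩ := E.exists_of_troubled_noAndTwoVars (h2.substConst x (finTwoEquiv dd)) hT
    have hBP' : E.ι T ≠ P := E.ι_ne T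
    have hBP : C.arg (E.ι T) aT = .gate P := by rw [← hargK _ aT hBP']; exact hTP
    have hBt : C.arg (E.ι T) aT.rev = .var t := by rw [← hargK _ aT.rev hBP']; exact hTt
    have hBand : IsAndOp (C.op (E.ι T)) := (E.isAndOp_iff T).mp hT.1
    have hPu : C.arg P a.rev = .var u := hrepl.symm.trans hru
    have hux : u ≠ x := fun h => hrx (by rw [hPu, h])
    obtain ⟨-, -, -, -, -, h2u, -⟩ := Troubled.exists_wires_of_reads hT ⟨aT, hTu⟩
    have h := E.fanout_repl_add
    rw [hru, E.pull_var] at h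
    have hc1 : (univ.filter fun a' : Fin 2 => (C.substConst x (finTwoEquiv dd)).arg P a' = .var u).card = 1 := by
      rw [card_eq_one]
      refine ⟨a.rev, ?_⟩
      ext a'
      simp only [mem_filter, mem_univ, true_and, mem_singleton]
      constructor
      · intro h'
        rcases fin2_eq_or_eq_rev a a' with rfl | rfl
        · rw [h₀'] at h'; cases h'
        · rfl
      · rintro rfl; rw [hr₀']; exact hPu
    rw [hc1, h2u] at h
    have hfu : (C.substConst x (finTwoEquiv dd)).fanout (.var u) = C.fanout (.var u) := C.fanout_substConst_var_of_ne _ _ hux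
    have hfP : (C.substConst x (finTwoEquiv dd)).fanout (.gate P) = C.fanout (.gate P) := C.fanout_substConst_gate _ _ P
    rw [hfu, hfP] at h
    have hu1' : 1 ≤ C.fanout (.var u) := one_le_fanout_of_arg_eq hPu
    -- `fanout u + fanout P = 3`
    rcases Nat.lt_or_ge (C.fanout (.gate P)) 1 with hP0 | hP1
    · -- `P` is the output, reading a live variable: impossible
      exfalso
      have hoP : C.out = .gate P := hN.out_of_fanout_eq_zero P (by omega)
      have hoP₀ : (C.substConst x (finTwoEquiv dd)).out = .gate P := by show C.out.substConst x (finTwoEquiv dd) = _; rw [hoP]; rfl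
      exact out_ne_of_live_var hf hd₁ hF₀ hC₀ h₀ (hr₀.trans hPu) hoP₀
    · rcases Nat.lt_or_ge (C.fanout (.gate P)) 2 with hP1' | hP2
      · exact case6_2_2_4 hf hd hF hC hS hφ hφ2 hI hQ hPx hxp (by omega) hBand hBP hBt
      · exact case6_2_2_oneVar hf hd hF hC hS hφ hφ2 hI hQ hPx hPu hxp (by omega)
  -- the good branch
  right
  refine ⟨fun T hT => htr ⟨T, hT⟩, ⟨hNK, fun G hG => hus ⟨G, hG⟩⟩, ?_⟩
  have hpotK : E.C'.potential ∅ = 0 := by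
    have : E.C'.troubledCount = 0 := by
      unfold troubledCount; rw [card_eq_zero, filter_eq_empty_iff]; exact fun T _ hT => htr ⟨T, hT⟩
    unfold potential; rw [this]; simp
  have hinfK : ((E.C'.influential (RdqSource.assignProtected he hxr dd)).card : ℝ) ≤ ((C.substConst x (finTwoEquiv dd)).influential (RdqSource.assignProtected he hxr dd)).card := by
    exact_mod_cast card_le_card (E.influential_subset (RdqSource.assignProtected he hxr dd))
  have hmK : ((E.C'.m : ℕ) : ℝ) + 1 = C.m := by exact_mod_cast E.m_add_one
  have hq' : ((R.quadCount : ℕ) : ℝ) = (RdqSource.assignProtected he hxr dd).quadCount + 1 := by exact_mod_cast hq₁.symm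
  show E.C'.measure αφ αI αQ ∅ (RdqSource.assignProtected he hxr dd) + 1 + αI + αQ ≤ C.measure αφ αI αQ ∅ R
  unfold measure
  rw [hpotK, hpotC, hq']
  nlinarith [mul_le_mul_of_nonneg_left hinf₀ hI, mul_le_mul_of_nonneg_left hinfK hI]

/-- **The dichotomy of Case 6, with semantics**: as `protSubst_dichotomy`, and in the second
branch the solutions of `C` with `x := d` restrict to solutions of the new circuit up to a fixed
pattern of negations (so the functions computed at kept gates are unchanged up to negation, and
dependencies on variables other than `x` are preserved). [cite: LiYang2022, §4.1 (Case 6)] -/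
theorem protSubst_dichotomy_sem (hf : IsAffineDisperser f d) (hd : 2 * d + 2 < R.dim) (hF : C.Fair)
    (hC : C.ComputesRestr f R) (hS : C.Standing R) (h2 : C.NoAndTwoVars)
    (hφ : 0 ≤ αφ) (hφ2 : αφ ≤ 1 / 2) (hI : 0 ≤ αI) (hQ : 0 ≤ αQ)
    {x : Fin n} {P : Fin C.m} {a : Fin 2} (hPx : C.arg P a = .var x)
    {l : Fin n} {e : QuadEq n} (he : R.quad l = some e) (hxr : e.Reads x) (dd : ZMod 2) :
    C.StepGoal f R αφ αI αQ ∨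
    ∃ E : ElimDataW (C.substConst x (finTwoEquiv dd)) P f (RdqSource.assignProtected he hxr dd) αφ αI αQ ∅ (1 - αφ),
      E.repl = C.arg P a.rev ∧ (∀ T, ¬ E.C'.Troubled T) ∧ E.C'.Normalized ∧
      E.C'.measure αφ αI αQ ∅ (RdqSource.assignProtected he hxr dd) + 1 + αI + αQ ≤ C.measure αφ αI αQ ∅ R ∧
      ∃ σ : Fin C.m → Bool, ∀ (xx : Fin n → Bool) (w : Fin C.m → Bool),
        C.Consistent (Function.update xx x (finTwoEquiv dd)) w →
        E.C'.Consistent xx (fun k' => (w (E.ι k') ^^ σ (E.ι k'))) := by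
  classical
  have hN := hS.normalized.1
  have hxp : R.Protected x := RdqSource.protected_of_reads he hxr
  obtain ⟨c₀, hc₀⟩ := hS.isXorOp_of_protected hxp hPx
  have hrx : C.arg P a.rev ≠ .var x := fun h => hN.arg_ne_arg_rev P a (hPx.trans h.symm)
  let b : Bool := finTwoEquiv dd
  have hF₀ : (C.substConst x b).Fair := hF.substConst x b
  have hC₀ : (C.substConst x b).ComputesRestr f (RdqSource.assignProtected he hxr dd) := hC.substConst_assignProtected he hxr dd
  have hd₁ : 2 * d + 2 ≤ (RdqSource.assignProtected he hxr dd).dim := by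
    have h1 := RdqSource.dim_assignProtected he hxr dd
    omega
  have h₀ : (C.substConst x b).arg P a = .const b := by
    show (C.arg P a).substConst x b = _; rw [hPx, Node.substConst_var_self]
  have hr₀ : (C.substConst x b).arg P a.rev = C.arg P a.rev := Node.substConst_of_ne hrx b
  have hdeg : ∀ t, (C.substConst x b).liveFn P a b t = (t ^^ (b ^^ c₀)) := by
    intro t
    have e1 : ∀ p q c : Bool, ((p ^^ q) ^^ c) = (q ^^ (p ^^ c)) := by decide
    have e2 : ∀ p q c : Bool, ((q ^^ p) ^^ c) = (q ^^ (p ^^ c)) := by decide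
    unfold liveFn
    show (if a = 0 then C.op P b t else C.op P t b) = _
    split_ifs
    · rw [hc₀]; exact e1 b t c₀
    · rw [hc₀]; exact e2 b t c₀
  obtain ⟨E, hrepl₀, σ, hσ⟩ := exists_elimDataW_degen_sem hf hd₁ hF₀ hC₀ (C.substConst x b).isPacking_empty h₀ hdeg hφ hI αQ
  have hrepl : E.repl = C.arg P a.rev := hrepl₀.trans hr₀
  rcases protSubst_dichotomy_of hf hd hF hC hS h2 hφ hφ2 hI hQ hPx he hxr dd E hrepl with h | ⟨hT, hNo, hμ⟩
  · exact Or.inl h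
  · refine Or.inr ⟨E, hrepl, hT, hNo, hμ, σ, fun xx w hw => hσ xx w ?_⟩
    exact (C.consistent_substConst_iff _ _ xx w).mpr hw

end Semicircuit

end Literature.Computability.Complexity
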